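import Summits.AnomalousDissipation.AnomalousDissipation.Theorems.BaireTransferDenseLoudDesignerForcesErgodicH3Smoothing
import Literature.Analysis.FunctionSpaces.TorusEnergyRellich
import Literature.Analysis.FunctionSpaces.TorusSobolevNormSmoothProofs
import Literature.Analysis.FluidPDE.StokesTorusDomainProofs

/-!
# Compactness of the model core `Λ = (1 + A) K_c` of an NS phase (tools stub `stub_modelCoreCompactTools` of block N,
# line `ergodic-budget-selection-closing`, crux `BaireTransfer.DenseLoudDesignerForces`, stmt-AnomalousDissipation-1143)

Block N of the line models the Navier–Stokes semiflow `φ` of an NS phase `(K, φ)` (`IsNSPhase ν F K φ`,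
`…ErgodicLine.lean`) near a compact core `K_c ⊆ φ_τ(K)` through the smoothing isomorphism `R = (1 + A)⁻¹`
(`A = Torus.stokesOperatorH (Fin 3)`, the Stokes operator in the energy space `H`; the resolvent is the neighbour
tools stub `stub_stokesResolventTools`, `Literature/Analysis/FluidPDE/StokesTorusResolvent.lean`).  The model core
is `Λ := R ⁻¹' K_c = (1 + A) K_c`, and the hyperbolic-semiflow-model interface needs it COMPACT in `H`.  This file
proves the registered tools stub `stub_modelCoreCompactTools`:

* `mem_domain_stokesOperatorH_of_rep_ae_eq` — a state of `H` with a smooth representative lies in `D(A)`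
  (`D(A) = H ∩ H²`, `Torus.mem_domain_stokesOperator_iff_holds`, and smooth fields lie in every `H^s`,
  `Torus.IsSmooth.memSobolev_holds`);
* `rep_stokesOperatorH_ae_eq` — for such a state `v` with smooth representative `w`, `A v` is represented by `-Δw`
  (the graph relation on the Fourier side, `Torus.IsStokesImage.mFourierCoeff_eq`: `(A v)^_k = 4π²|k|² v̂_k`, against
  `𝓕(Δw)(k) = -4π²|k|² ŵ(k)`, `Torus.mFourierCoeff_complexify_laplacian`, and uniqueness of Fourier coefficients);
* `stub_modelCoreCompactTools` — for `ν > 0`, `τ > 0` and a compact `K_c ⊆ φ_τ(K)`: every state of `K_c` has the smooth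
  representative `u(τ)` of a classical trajectory, with `‖∇u(τ)‖₂²`, `‖Δu(τ)‖₂²`, `‖∇Δu(τ)‖₂²` bounded uniformly
  (parabolic smoothing: `IsNSPhase.exists_forall_gradNormSq_le`, `…integral_norm_laplacian_sq_le`,
  `…gradNormSq_laplacian_le` of `…ErgodicH2Smoothing` / `…ErgodicH3Smoothing`); hence `K_c ⊆ D(A)`, `R` maps
  `R ⁻¹' K_c` onto `K_c`, and `R ⁻¹' K_c = {v + A v | v ∈ K_c}` is closed (preimage of a compact set under the
  continuous `R`), bounded (`‖v + A v‖ ≤ ‖v‖ + ‖Δu(τ)‖₂`) and of bounded enstrophy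
  (`‖∇(u − Δu)‖₂² ≤ 2‖∇u‖₂² + 2‖∇Δu‖₂²`), hence compact by Rellich in the energy space
  (`Torus.isCompact_energySpace_of_isClosed_of_eGradNormSq_le`).

References: Constantin–Foias, *Navier–Stokes Equations* (1988) Ch. 4 (4.35)–(4.37) (`D(A) = H ∩ H²`, `(Au)_k = 4π²|k|²u_k`,
compactness of `V ⊂ H`); Robinson–Rodrigo–Sadowski, *The Three-Dimensional Navier–Stokes Equations* (CUP 2016) Thm 1.19,
Thm 7.1–7.5 (Rellich on the torus; parabolic smoothing).
-/

-- `Summit.<Summit>.<Problem>` is the tree's mandated summit-side namespace (CONVENTIONS §2); for this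
-- single-conjunct summit the two coincide, so the duplicate is deliberate.
set_option linter.dupNamespace false

noncomputable section

open scoped BigOperators Topology ENNReal InnerProductSpace
open Filter Set Function MeasureTheory

namespace Summit.AnomalousDissipation.AnomalousDissipation.Theorems.DenseLoudDesignerForces.Ergodic

open Literature.Analysis.FunctionSpaces Literature.Analysis.FunctionSpaces.Torus
open Literature.Analysis.FluidPDE Literature.Analysis.FluidPDE.Torus
open Summit.AnomalousDissipation.AnomalousDissipation.Theses.BaireTransfer
open Summit.AnomalousDissipation.AnomalousDissipation.Theorems.DenseLoudDesignerForces.Negative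

variable {ν : ℝ} {F : (UnitAddTorus (Fin 3)) → (EuclideanSpace ℝ (Fin 3))} {K : Set Hsp} {φ : ℝ → Hsp → Hsp}

/-! ## States with a smooth representative: membership in `D(A)` and the action of `A` -/

/-- **A state of `H` with a smooth representative lies in `D(A)`**: `D(A) = H ∩ H²(T³; ℝ³)` (Constantin–Foias 1988,
Ch. 4 (4.35), the tree's `Torus.mem_domain_stokesOperator_iff_holds` transported to the `H`-valued operator by
`Torus.mem_domain_stokesOperatorH_iff`), the spectral class `H²` only sees the a.e.-class (`memSobolev_congr_ae`), and a
smooth field lies in every `H^s` (`Torus.IsSmooth.memSobolev_holds`). [cite: ConstantinFoiasNSE1988, Ch. 4 (4.35)] -/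
theorem mem_domain_stokesOperatorH_of_rep_ae_eq (v : Hsp) {w : (UnitAddTorus (Fin 3)) → (EuclideanSpace ℝ (Fin 3))}
    (hw : IsSmooth w) (h : rep v =ᵐ[volume] w) : v ∈ (stokesOperatorH (Fin 3)).domain := by
  have h' : ((v : Lp (EuclideanSpace ℝ (Fin 3)) 2 (volume : Measure (UnitAddTorus (Fin 3)))) :
      (UnitAddTorus (Fin 3)) → (EuclideanSpace ℝ (Fin 3))) =ᵐ[volume] w := h
  rw [mem_domain_stokesOperatorH_iff]
  refine (mem_domain_stokesOperator_iff_holds (d := Fin 3)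
    (v : Lp (EuclideanSpace ℝ (Fin 3)) 2 (volume : Measure (UnitAddTorus (Fin 3))))).2 ⟨v.2, ?_⟩
  rw [memSobolev_congr_ae (complexify_comp_congr_ae h')]
  exact IsSmooth.memSobolev_holds (d := Fin 3) (F := EuclideanSpace ℂ (Fin 3)) hw.complexify_comp 2

/-- **The Stokes operator acts as `-Δ` on smooth representatives**: if the state `v ∈ D(A)` is represented by the smooth
field `w`, then `A v` is represented by `-Δw`.  Proof on the Fourier side: `(v, A v)` lies in the Stokes graph, so
`𝓕(A v)(k) = 4π²|k|² v̂(k)` (`Torus.IsStokesImage.mFourierCoeff_eq`; Constantin–Foias 1988, Ch. 4 (4.37)), while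
`𝓕(-Δw)(k) = 4π²|k|² ŵ(k) = 4π²|k|² v̂(k)` (`Torus.mFourierCoeff_complexify_laplacian`); two integrable fields with the
same coefficients agree a.e. (`Torus.ae_eq_of_forall_mFourierCoeff_eq`). [cite: ConstantinFoiasNSE1988, Ch. 4 (4.37)] -/
theorem rep_stokesOperatorH_ae_eq (v : Hsp) (hv : v ∈ (stokesOperatorH (Fin 3)).domain)
    {w : (UnitAddTorus (Fin 3)) → (EuclideanSpace ℝ (Fin 3))} (hw : IsSmooth w) (h : rep v =ᵐ[volume] w) :
    rep (stokesOperatorH (Fin 3) ⟨v, hv⟩) =ᵐ[volume] -laplacian w := by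
  have h' : ((v : Lp (EuclideanSpace ℝ (Fin 3)) 2 (volume : Measure (UnitAddTorus (Fin 3)))) :
      (UnitAddTorus (Fin 3)) → (EuclideanSpace ℝ (Fin 3))) =ᵐ[volume] w := h
  have himg : IsStokesImage (v : Lp (EuclideanSpace ℝ (Fin 3)) 2 (volume : Measure (UnitAddTorus (Fin 3))))
      ((stokesOperatorH (Fin 3) ⟨v, hv⟩ : Hsp) : Lp (EuclideanSpace ℝ (Fin 3)) 2 (volume : Measure (UnitAddTorus (Fin 3)))) :=
    Submodule.mem_graph_toLinearPMap stokesGraphH_fst_eq_zero_imp (⟨v, hv⟩ : (stokesOperatorH (Fin 3)).domain)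
  have hneg : (EuclideanSpace.complexify ∘ (-laplacian w)) = -(EuclideanSpace.complexify ∘ laplacian w) := by
    funext y
    simp only [Function.comp_apply, Pi.neg_apply, map_neg]
  have hcoef : ∀ k : Fin 3 → ℤ,
      UnitAddTorus.mFourierCoeff (EuclideanSpace.complexify ∘
        (((stokesOperatorH (Fin 3) ⟨v, hv⟩ : Hsp) : Lp (EuclideanSpace ℝ (Fin 3)) 2 (volume : Measure (UnitAddTorus (Fin 3)))) :
          (UnitAddTorus (Fin 3)) → (EuclideanSpace ℝ (Fin 3)))) k =
      UnitAddTorus.mFourierCoeff (EuclideanSpace.complexify ∘ (-laplacian w)) k := fun k => by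
    rw [himg.mFourierCoeff_eq v.2 (stokesOperatorH (Fin 3) ⟨v, hv⟩).2 k,
      mFourierCoeff_congr_ae (complexify_comp_congr_ae h') k, hneg, mFourierCoeff_neg,
      mFourierCoeff_complexify_laplacian hw k, neg_neg, stokesEigenvalue]
  have hi1 : Integrable (EuclideanSpace.complexify ∘
      (((stokesOperatorH (Fin 3) ⟨v, hv⟩ : Hsp) : Lp (EuclideanSpace ℝ (Fin 3)) 2 (volume : Measure (UnitAddTorus (Fin 3)))) :
        (UnitAddTorus (Fin 3)) → (EuclideanSpace ℝ (Fin 3)))) volume :=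
    integrable_complexify_comp ((Lp.memLp _).integrable one_le_two)
  have hi2 : Integrable (EuclideanSpace.complexify ∘ (-laplacian w)) volume :=
    integrable_complexify_comp hw.laplacian.neg.integrable
  exact (ae_eq_of_forall_mFourierCoeff_eq hi1 hi2 hcoef).mono fun y hy => EuclideanSpace.complexify_injective hy

/-! ## The registered tools stub -/

/-- **Tools stub N0e — compactness of the model core `Λ = (1 + A) K_c`** (registered tools stub
`stub_modelCoreCompactTools` of block N, crux stmt-AnomalousDissipation-1143, line `ergodic-budget-selection-closing`).
For an NS phase `(K, φ)` at `ν > 0`, a compact `K_c ⊆ φ_τ(K)` (`τ > 0`) consists of states with smooth representatives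
`u(τ)` bounded in `H³` (parabolic smoothing: uniform bounds on `‖∇u‖₂`, `‖Δu‖₂`, `‖∇Δu‖₂` on `φ_t(K)`, `t ≥ τ`, from
`…ErgodicH2Smoothing` / `…ErgodicH3Smoothing`); hence `K_c ⊆ D(A)` (`mem_domain_stokesOperatorH_of_rep_ae_eq`), and for
any resolvent `R = (1 + A)⁻¹` (the two identities `hR`, `hR'`) the model core `R ⁻¹' K_c = {v + A v | v ∈ K_c}` is
closed (preimage of a compact set under the continuous `R`), bounded in `H` (`‖v + A v‖ ≤ ‖v‖ + ‖Δu(τ)‖₂`,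
`rep_stokesOperatorH_ae_eq`) and of bounded enstrophy (`‖∇(u − Δu)‖₂² ≤ 2‖∇u‖₂² + 2‖∇Δu‖₂²`), hence COMPACT by Rellich
on the energy space (`Torus.isCompact_energySpace_of_isClosed_of_eGradNormSq_le`; Constantin–Foias 1988 Ch. 4: the
injection `V ⊂ H` is compact), and `R` maps it onto `K_c` (`R (v + A v) = v`). [folklore] -/
theorem stub_modelCoreCompactTools {ν : ℝ} {F : (UnitAddTorus (Fin 3)) → (EuclideanSpace ℝ (Fin 3))} {K : Set Hsp}
    {φ : ℝ → Hsp → Hsp} (hν : 0 < ν) (hK : IsNSPhase ν F K φ) (R : Hsp →L[ℝ] Hsp)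
    (hR : ∀ v : Hsp, ∃ hv : R v ∈ (stokesOperatorH (Fin 3)).domain, R v + stokesOperatorH (Fin 3) ⟨R v, hv⟩ = v)
    (hR' : ∀ (v : Hsp) (hv : v ∈ (stokesOperatorH (Fin 3)).domain), R (v + stokesOperatorH (Fin 3) ⟨v, hv⟩) = v)
    {Kc : Set Hsp} (hKc : IsCompact Kc) {τ : ℝ} (hτ : 0 < τ) (hsub : Kc ⊆ φ τ '' K) :
    IsCompact (R ⁻¹' Kc) ∧ R '' (R ⁻¹' Kc) = Kc ∧ ∀ v ∈ Kc, v ∈ (stokesOperatorH (Fin 3)).domain := by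
  -- uniform `H¹`, `H²`, `H³` bounds on `φ_t(K)`, `t ≥ τ` (parabolic smoothing)
  obtain ⟨E₁, hE₁⟩ := hK.exists_forall_gradNormSq_le
  obtain ⟨C₂, hC₂⟩ := hK.exists_forall_integral_norm_laplacian_sq_le hν hτ
  obtain ⟨C₃, hC₃⟩ := hK.exists_forall_gradNormSq_laplacian_le hν hτ
  -- every state of `K_c` has a smooth representative obeying these bounds
  have hrepKc : ∀ v ∈ Kc, ∃ w : (UnitAddTorus (Fin 3)) → (EuclideanSpace ℝ (Fin 3)), IsSmooth w ∧
      rep v =ᵐ[volume] w ∧ gradNormSq w ≤ E₁ ∧ ∫ y, ‖laplacian w y‖ ^ 2 ≤ C₂ ∧ gradNormSq (laplacian w) ≤ C₃ := by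
    intro v hv
    obtain ⟨x, hx, rfl⟩ := hsub hv
    obtain ⟨u, p, hsol, hrep⟩ := hK.trajectory x hx
    exact ⟨u τ, hsol.smooth_velocity.isSmooth_slice (mem_Ici.2 hτ.le), hrep τ hτ.le,
      hE₁ x hx u p hsol hrep τ hτ.le, hC₂ x hx u p hsol hrep τ le_rfl, hC₃ x hx u p hsol hrep τ le_rfl⟩
  -- `K_c ⊆ D(A)`
  have hdom : ∀ v ∈ Kc, v ∈ (stokesOperatorH (Fin 3)).domain := fun v hv => by
    obtain ⟨w, hw, hrep, -, -, -⟩ := hrepKc v hv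
    exact mem_domain_stokesOperatorH_of_rep_ae_eq v hw hrep
  -- the representative of a point `z = R z + A (R z)` of the model core
  have hcore : ∀ z ∈ R ⁻¹' Kc, ∀ (hv : R z ∈ (stokesOperatorH (Fin 3)).domain),
      R z + stokesOperatorH (Fin 3) ⟨R z, hv⟩ = z →
      ∀ w : (UnitAddTorus (Fin 3)) → (EuclideanSpace ℝ (Fin 3)), IsSmooth w → rep (R z) =ᵐ[volume] w →
      rep z =ᵐ[volume] w + -laplacian w := by
    intro z _ hv hz w hw hrep
    have hA := rep_stokesOperatorH_ae_eq (R z) hv hw hrep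
    have hsum : rep (R z + stokesOperatorH (Fin 3) ⟨R z, hv⟩) =ᵐ[volume]
        rep (R z) + rep (stokesOperatorH (Fin 3) ⟨R z, hv⟩) := by
      show (((R z + stokesOperatorH (Fin 3) ⟨R z, hv⟩ : Hsp) :
          Lp (EuclideanSpace ℝ (Fin 3)) 2 (volume : Measure (UnitAddTorus (Fin 3)))) :
          (UnitAddTorus (Fin 3)) → (EuclideanSpace ℝ (Fin 3))) =ᵐ[volume] _
      rw [Submodule.coe_add]
      exact Lp.coeFn_add _ _
    rw [hz] at hsum
    filter_upwards [hsum, hrep, hA] with y hy h1 h2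
    rw [hy, Pi.add_apply, h1, h2, Pi.add_apply]
  -- `K_c` is bounded
  obtain ⟨B, hB⟩ := hKc.isBounded.exists_norm_le
  refine ⟨isCompact_energySpace_of_isClosed_of_eGradNormSq_le (hKc.isClosed.preimage R.continuous)
    (R₀ := B + Real.sqrt C₂) (R₁ := ENNReal.ofReal (2 * E₁ + 2 * C₃)) ENNReal.ofReal_ne_top
    (fun z hz => ?_) (fun z hz => ?_), ?_, hdom⟩
  · -- norm bound: `‖z‖ ≤ ‖R z‖ + ‖A (R z)‖ ≤ B + √C₂`
    obtain ⟨hv, hz'⟩ := hR z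
    obtain ⟨w, hw, hrep, -, h2, -⟩ := hrepKc (R z) hz
    have hA := rep_stokesOperatorH_ae_eq (R z) hv hw hrep
    have hsq : ‖stokesOperatorH (Fin 3) ⟨R z, hv⟩‖ ^ 2 ≤ C₂ :=
      calc ‖stokesOperatorH (Fin 3) ⟨R z, hv⟩‖ ^ 2 = ∫ y, ‖(-laplacian w) y‖ ^ 2 :=
            stub_trajectoryPowerBudget_aux_norm_sq _ hA
        _ = ∫ y, ‖laplacian w y‖ ^ 2 := by simp only [Pi.neg_apply, norm_neg]
        _ ≤ C₂ := h2
    have hnA : ‖stokesOperatorH (Fin 3) ⟨R z, hv⟩‖ ≤ Real.sqrt C₂ := by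
      rw [← Real.sqrt_sq (norm_nonneg (stokesOperatorH (Fin 3) ⟨R z, hv⟩))]
      exact Real.sqrt_le_sqrt hsq
    calc ‖z‖ = ‖R z + stokesOperatorH (Fin 3) ⟨R z, hv⟩‖ := by rw [hz']
      _ ≤ ‖R z‖ + ‖stokesOperatorH (Fin 3) ⟨R z, hv⟩‖ := norm_add_le _ _
      _ ≤ B + Real.sqrt C₂ := add_le_add (hB _ hz) hnA
  · -- enstrophy bound: `‖∇(w − Δw)‖₂² ≤ 2‖∇w‖₂² + 2‖∇Δw‖₂² ≤ 2E₁ + 2C₃`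
    obtain ⟨hv, hz'⟩ := hR z
    obtain ⟨w, hw, hrep, h1, -, h3⟩ := hrepKc (R z) hz
    have hz_rep := hcore z hz hv hz' w hw hrep
    have hsm : IsSmooth (w + -laplacian w) := hw.add hw.laplacian.neg
    -- `‖∇(-Δw)‖₂² = ‖∇Δw‖₂²` (pointwise `∂ᵢ(-g) = -∂ᵢ g`, `Torus.partialDeriv_neg`)
    have hgn : gradNormSq (-laplacian w) = gradNormSq (laplacian w) := by
      show gradNormSq (fun y => -laplacian w y) = gradNormSq (laplacian w)
      unfold gradNormSq
      simp_rw [partialDeriv_neg, norm_neg]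
    have hle : gradNormSq (w + -laplacian w) ≤ 2 * E₁ + 2 * C₃ := by
      have h := gradNormSq_add_le hw hw.laplacian.neg
      rw [hgn] at h
      linarith
    show eGradNormSq (rep z) ≤ ENNReal.ofReal (2 * E₁ + 2 * C₃)
    rw [Literature.Analysis.FluidPDE.eGradNormSq_congr_ae hz_rep, eGradNormSq_eq_ofReal_gradNormSq hsm]
    exact ENNReal.ofReal_le_ofReal hle
  · -- `R` maps the model core onto `K_c`: `R (v + A v) = v`
    exact Set.image_preimage_eq_of_subset fun v hv =>
      ⟨v + stokesOperatorH (Fin 3) ⟨v, hdom v hv⟩, hR' v (hdom v hv)⟩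

end Summit.AnomalousDissipation.AnomalousDissipation.Theorems.DenseLoudDesignerForces.Ergodic

end
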